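import Literature.MathematicalPhysics.QuantumFieldTheory.Balaban1983to89.B9Eq3117Current

/-!
# `Balaban1983to89.B9Eq336CurrentBound` — B9 p. 396 (3.35)–(3.36) ⟹ the bound `|J| ≦ O(1)·Mα₀·(Lʲη)⁻³` on the current
# `J = D*η⁻²Im ∂U` of (3.11), as used on pp. 421–422; kernel-checked in the exact-background lattice vocabulary of `B9Eq39Adjoint`

HONEST FRAMING (cell `lit-balaban`, verbatim): statement-level skeleton of published theorems with citation tags; proofs
where landed; nothing here is a claim about the Yang–Mills mass gap.

DOCFIX (cell `lit-balaban`, seat r06 gen 15, 2026-08-22; p37 `CITELOC-SWEEP-B4B9.md` §2b page-numeral slips, text layer re-read): (3.137) is p. 423 [PDF 35] ((3.136) p. 422; p. 422 ends «The inequality (149) in [5] implies») — the locators of (3.137) in this file corrected accordingly (1 place(s)); declarations, statements and proofs byte-identical to the tree copy of record (p248437).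

CITATION HEADER (lean-in-tree rule).  T. Bałaban, *Propagators for lattice gauge theories in a background field*, Commun.
Math. Phys. **99** (1985) 389–434 [`Balaban1985BackgroundPropagators`] (cell paper B9; `paper:balaban1985-cmp99-background-propagators`,
journal page = PDF page + 388), p. 396 [PDF 8] (3.35)–(3.36), p. 392 [PDF 4] (3.8)–(3.11), p. 395 [PDF 7] (3.30), pp. 421–422
[PDF 33–34]; re-read as images by this seat (render `b2b-balaban-ref1/pages/1985-cmp99-background-propagators/…-p008-x2.png`,
2026-08-21) and from the held text (`lit read`, pp. 4, 8, 33–34).  Cell `lit-balaban` seat r06 gen 4 (B9 fold owner), SKELETON rows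
`B9.Eq3.35` ((3.35)–(3.36)), `B9.Eq3.11` (J), and the `|J|`-input of rows `B9.Eq3.130` ((3.131)) / `B9.Eq3.134` ((3.137)).

WHAT IS PRINTED («…» verbatim).
* p. 392 (3.11): «Let us write the linear term in (3.7) as ⟨A,J⟩ = Σ_{b⊂T_η} η^d tr A(b)J(b), (3.11) where J = D*η⁻² Im ∂U,
  (∂U)(p) = U(∂p).» — `B9Eq39Adjoint.J` (with (3.8)/(3.9) `covDstar`/`divP`, the complexified `Im` of p. 391 `B9Eq37Insertion.imC`).
* p. 396 (3.35)–(3.36): «for an arbitrary cube □ of the described above class, and for a configuration U there exists a gauge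
  transformation u on □ such that U^u = e^{iηA}. and if the index of □ is j, then |A| < O(1)Mα₀(Lʲη)⁻¹, |∇^ηA| < O(1)Mα₀(Lʲη)⁻²
  on □, where O(1)M is a size of □ in T_{L^{−j}}; (3.35)  |∂^{η*}∂^ηA| < O(1)Mα₀(Lʲη)⁻³ on □. (3.36)  The number α₀ characterizes
  this class of configurations. We will need α₀ so small that O(1)Mα₀ is still a sufficiently small number. … For the operators
  introduced until now we need only the condition (3.35), but later on we will have to assume (3.36) also.»
* p. 421: «Fortunately they are connected with the linear term in the expansion (3.12), so they are small because the
  configuration J is small.»; p. 422, after (3.131) («|⟨A₁,Δ′_πA₂⟩| ≦ O(1)Mα₀(…)») and (3.136): «From the regularity condition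
  (3.36) and the inequality (3.133) we have the estimate |(H*J)(b)| ≦ O(1)Mα₀(Lʲη)⁻³ for b ∈ Λ_j.»
The print USES (3.36) only through the pointwise smallness of the current, `|J| ≦ O(1)Mα₀(Lʲη)⁻³` on the cubes of index `j`;
the one-line reason (`J` is `∂^{η*}∂^ηA` plus terms quadratic in `A`, `∇^ηA` in the gauge of (3.35), and `J` is gauge covariant
by (3.30)) is not displayed.  The two landed consumers carry exactly this bound as a hypothesis of printed shape:
`B9Ineq3131Assembly.ineq3131_assembled` (`hJ : ‖J(b)‖ ≦ c_J·Mα₀·(L^{j(b)}η)⁻³`, row B9.Eq3.130) and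
`B9Delta2Def134.ineq3137a_of_3133_336` (`h336`, row B9.Eq3.134).

WHAT THIS FILE PROVES (theorems; definitions with bodies `word`, `rho`, the explicit real budget `errB`, and (v1.1) the
regularity predicate `RegularAt`; no `Prop` placeholders, nothing of the series assumed; §1 = private real/normed-ring helpers).  MODEL = the pv27 vocabulary of `B9Eq39Adjoint`/`B9Eq3117Current`: a complete
normed ℂ-algebra `𝔸`, an abstract finite lattice (sites `S`, directions `ι` finite and ordered, shifts `T μ : S ≃ S` COMMUTING —
plaquettes close, p. 391), a configuration of units; `covD`/`covDstar`/`curl`/`divP`/`curlη`/`divPη`/`plaqU`/`J`/`fluct` BY NAME.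
The flat operators of (3.35)–(3.36) are the same operators at the trivial background `U ≡ 1`: `∇^η` ↦ `η⁻¹·covD T 1` (unit-lattice
difference; the hypothesis is stated as `‖covD T 1 κ (A ν) z‖ ≦ η·bound`, as in `B9Eq369Product.norm_eta_inv_smul_le_iff`),
`∂^η` ↦ `curlη T 1 η`, `∂^{η*}∂^η` ↦ `divPη T 1 η (curlη T 1 η ·)`.
* §2–§4 THE PLAQUETTE FUNCTION OF `U = e^{iηA}` TO SECOND ORDER, EXACTLY: `U(∂p) = Π_{b⊂∂p} e^{iη(±A(b))}` (`plaqU_fluct`, the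
  word `[A_μ(x), A_ν(x+e_μ), −A_μ(x+e_ν), −A_ν(x)]`); `Πe^{a_k} − Πe^{−a_k}(rev.) = 2Σa_k + Σ_{j<k}[a_j,a_k] + (E − E′)`
  (`holonomy_sub_holonomy_invPath`: the `(Σa)²` parts of `TransportVertices.quad` cancel, the commutators add); hence
  **`η⁻²Im U(∂p) = (∂^ηA)(p) + (i/2)Σ_{j<k}[A_j,A_k] + ρ_p`** (`imC_plaqU_fluct`) with `‖ρ_p‖ ≦ η·s³e^{ηs}/6` for word size `≦ s`
  (`norm_rho_le`; third order AND a factor `η`), `|η⁻²Im U(∂p)| ≦ η⁻¹(g₁+g₂) + s²/2 + ηs³e^{ηs}/6` (`norm_F_le`).  No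
  Baker–Campbell–Hausdorff series is needed: the second-order Taylor expansion of the ordered product
  (`B9Eq37Insertion.rem`, `norm_rem_letters_le`) suffices.
* §5 THE CURRENT, DECOMPOSED: `D*_{U,ν} = D*_{1,ν} + (e^{−iηA_ν(y)}(·)e^{iηA_ν(y)} − 1)` at `y = x − e_ν` (`covDstar_fluct`, size
  `(e^{2η|A|} − 1)` by `B9Eq370Expansion.norm_conj_sub_le`); `J_μ(x) = η⁻¹Σ_ν(D*_νF_{νμ})(x)` ((3.9) last form, `J_eq_sum`); and
  **`J_μ(x) = (∂^{η*}∂^ηA)_μ(x) + η⁻¹Σ_{ν≠μ}[transport + (i/2)(C(p′) − C(p)) + (ρ_{p′} − ρ_p)]`** (`J_fluct_decomp`,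
  `summand_self_eq_zero`).
* §6 THE ESTIMATE: per direction `≦ B(η,a,g)` (`errB`, `norm_summand_le`: transport `(e^{2ηa} − 1)·|F|`, commutator difference by
  the product rule `12ag` (`norm_commSum_four_sub_le`), remainder `2‖ρ‖` WITHOUT differencing); hence
  **`|J_μ(x)| ≦ t + (d − 1)η⁻¹B(η,a,g)`** from `|A| ≦ a`, unit differences `≦ g`, `|(∂^{η*}∂^ηA)_μ(x)| ≦ t` — LOCAL form with the
  hypotheses on a site set `N` ⊇ stencil of the bond («on □», `norm_J_fluct_le_local`) and GLOBAL form (`norm_J_fluct_le`).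
* §7 THE SCALES OF (3.35)–(3.36): `a = εξ⁻¹`, `g = η·εξ⁻²`, `t = εξ⁻³`, `ξ = Lʲη ≧ η`, `ε = O(1)Mα₀ ≦ 1` give `η⁻¹B ≦ 10⁴ε²ξ⁻³`
  (`budget`; `e² ≦ 7.4`, `e⁴ ≦ 54.6` from `Real.exp_one_lt_d9`), so **`|J| ≦ (1 + 10⁴(d−1)ε)·εξ⁻³ ≦ 10⁴d·εξ⁻³`**
  (`norm_J_fluct_le_scaled`, `_crude`; printed letters `norm_J_fluct_le_printed`): leading term = the (3.36) bound itself.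
* §8 GENERAL BACKGROUND: gauge transfer by (3.30) `J^u = R(u)J` (`B9Eq3117Current.J_gaugeTr` BY NAME; `‖u‖, ‖u⁻¹‖ ≦ 1`,
  `norm_J_le_of_gaugeTr`), locality of `J_μ(x)` in the configuration (`J_congr`), and the assembled statements
  **`norm_J_le_local`** (U^u = e^{iηA} on the bonds out of `N` ⊇ stencil) and **`norm_J_le_printed`** / **`_crude`**
  (`|J(b)| ≦ (1 + 10⁴(d−1)C)·C·(Lʲη)⁻³ ≦ 10⁴d·C·(Lʲη)⁻³`, `C = O(1)Mα₀ ≦ 1`, `L ≧ 1`) — the shape of the consumers' `hJ`/`h336`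
  with `c_J·Mα₀ ↦ 10⁴d·C`.
* §9 (v1.1, append-only) BLOCK-INDEXED PACKAGING: `norm_J_le_local_scaled` (local form at the (3.35) scales), the predicate
  `RegularAt T U η C ξ μ x` (= the datum of (3.35)–(3.36) at one bond: gauge, field, site set ⊇ stencil, bounds at scale `ξ`),
  `norm_J_le_of_regularAt`, and **`norm_J_le_blocks`**: with a block map `blk : S → 𝔅` and scales `len(y) ≧ η`, regularity at
  every bond at the scale of its block gives `∀ μ x, |J_μ(x)| ≦ 10⁴d·C·(len(blk x)³)⁻¹` — LITERALLY the hypothesis `hJ` of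
  `B9Ineq3131Assembly.ineq3131_assembled` (`c_J = 10⁴d`, `Mα₀ ↦ C`).

SCOPE / NOT CLAIMED.  (i) The constants `10⁴`, `d − 1` are this file's bookkeeping, not the print's `O(1)`; sharper constants
are immediate from `errB`.  (ii) «on □»: the local theorems take the hypotheses on an abstract site set `N` containing the
explicit stencil of the bond; the covering statement (which cube of the class of p. 396 carries a given bond and its stencil,
and the overlap of cubes of different indices) is the geometry of (3.16)/p. 396, not typed here (cf. `B9Eq335Plaquette`,
GAPS C-B9-42) — a consumer with a block-dependent scale (`B9Ineq3131Assembly`'s `g.len (blk x)`) instantiates `norm_J_le_local`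
bond by bond.  (iii) `∇^ηA` in (3.35) is read as the ordinary lattice gradient of the components of `A` (all `d` directions);
`∂^{η*}∂^η` as the flat plaquette operator `D*D` of (3.9)–(3.10) at `U ≡ 1` («generalizing the operator ∂*∂ in the Abelian
case», p. 392).  (iv) Unitarity enters only through `‖u(x)‖, ‖u(x)⁻¹‖ ≦ 1` in §8; §2–§7 hold in any complete normed ℂ-algebra
(complex `A` allowed).  (v) Nothing of Theorems 3.1–3.15, (3.131), (3.133), (3.137) is proved here; this file discharges one
displayed-by-reference input of their bookkeeping (GAPS G-B9-16's «(3.36) ⇒ |J|» item).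

RELATED IN THE TREE, NOT DUPLICATED (searched 2026-08-21: `lean search 'norm_J_|J_bound|Reg336|h336|hJ'`, `ls Balaban1983to89/B9*`):
`B9Eq335Plaquette` ((3.35) ⇒ B7 (52): `‖U(∂p) − 1‖ ≦ 2C(1+C)e^{4C}ξ²`, ZEROTH order in the plaquette — here SECOND order and one
more derivative); `B9Eq369Product`/`B9Eq369Small` ((3.69): `|Re U′U(∂p) − 1|`, `|Im U′U(∂p)| ≦ O(1)(C₀+α₁)ξ²` and the smallness of
`Δ′`); `B9Eq370Expansion` ((3.70)–(3.74): `D_{U′U} − D_U`, used BY NAME for the transport correction); `B9Eq3117Current` (`D*J = 0`,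
`J^u = R(u)J`, used BY NAME); `B9.Backgrounds.Reg335/Reg336` (abstract Prop fields of the by-reference leaf `B9.lean`);
`B9Ineq3131Assembly`, `B9Delta2Def134` (consumers of the bound as a hypothesis).  None bounds `J` from (3.35)–(3.36).
-/

noncomputable section

open NormedSpace Complex

namespace Literature.MathematicalPhysics.QuantumFieldTheory.Balaban1983to89.B9Eq336CurrentBound

open Literature.MathematicalPhysics.QuantumFieldTheory.Balaban1983to89
open Literature.MathematicalPhysics.QuantumFieldTheory.Balaban1983to89.Beta.TransportVertices
open Literature.MathematicalPhysics.QuantumFieldTheory.Balaban1983to89.Beta.AdjointTransportJets (invPath invPath_cons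
  invPath_nil sum_inv)
open Literature.MathematicalPhysics.QuantumFieldTheory.Balaban1983to89.B9Eq37Insertion
open Literature.MathematicalPhysics.QuantumFieldTheory.Balaban1983to89.B9Eq39Adjoint
open Literature.MathematicalPhysics.QuantumFieldTheory.Balaban1983to89.B9Eq369Product (val_fluct val_inv_fluct)
open Literature.MathematicalPhysics.QuantumFieldTheory.Balaban1983to89.B9Eq370Expansion (norm_conj_sub_le norm_Iη_smul
  norm_R_le)
open Literature.MathematicalPhysics.QuantumFieldTheory.Balaban1983to89.B9Eq3117Current (gaugeTr J_gaugeTr plaqU_swap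
  imC_plaqU_swap)

/-! ## §1  Elementary inequalities -/

section Elementary

/-- `eˣ − 1 ≦ x·eˣ` for every real `x` (from `1 − x ≦ e⁻ˣ`). [folklore] -/
private theorem exp_sub_one_le_mul_exp (x : ℝ) : Real.exp x - 1 ≤ x * Real.exp x := by
  have h := Real.add_one_le_exp (-x)
  have hpos := Real.exp_pos x
  have h1 : (-x + 1) * Real.exp x ≤ Real.exp (-x) * Real.exp x :=
    mul_le_mul_of_nonneg_right h hpos.le
  rw [← Real.exp_add, neg_add_cancel, Real.exp_zero] at h1
  linarith

/-- `e² ≦ 7.4`. [folklore] -/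
private theorem exp_two_le : Real.exp 2 ≤ 7.4 := by
  have h := Real.exp_one_lt_d9
  have h2 : Real.exp 2 = Real.exp 1 ^ 2 := by
    rw [← Real.exp_nat_mul]; norm_num
  rw [h2]
  exact (pow_le_pow_left₀ (Real.exp_pos 1).le h.le 2).trans (by norm_num)

/-- `e⁴ ≦ 54.6`. [folklore] -/
private theorem exp_four_le : Real.exp 4 ≤ 54.6 := by
  have h := Real.exp_one_lt_d9
  have h4 : Real.exp 4 = Real.exp 1 ^ 4 := by
    rw [← Real.exp_nat_mul]; norm_num
  rw [h4]
  exact (pow_le_pow_left₀ (Real.exp_pos 1).le h.le 4).trans (by norm_num)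

variable {𝔸 : Type*} [NormedRing 𝔸]

/-- Six summands under one norm. [folklore] -/
private theorem norm_add₆_le (p₁ p₂ p₃ p₄ p₅ p₆ : 𝔸) :
    ‖p₁ + p₂ + p₃ + p₄ + p₅ + p₆‖ ≤ ‖p₁‖ + ‖p₂‖ + ‖p₃‖ + ‖p₄‖ + ‖p₅‖ + ‖p₆‖ := by
  have h3 : ‖p₁ + p₂ + p₃‖ ≤ ‖p₁‖ + ‖p₂‖ + ‖p₃‖ := norm_add₃_le
  have h4 := (norm_add_le (p₁ + p₂ + p₃) p₄).trans (add_le_add h3 le_rfl)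
  have h5 := (norm_add_le (p₁ + p₂ + p₃ + p₄) p₅).trans (add_le_add h4 le_rfl)
  exact (norm_add_le _ p₆).trans (add_le_add h5 le_rfl)

/-- Difference of two commutators: `[x,y] − [x′,y′] = (x − x′)y + x′(y − y′) − (y − y′)x − y′(x − x′)`. [folklore] -/
private theorem comm_sub_comm (x y x' y' : 𝔸) :
    (x * y - y * x) - (x' * y' - y' * x') = (x - x') * y + x' * (y - y') - (y - y') * x - y' * (x - x') := by
  noncomm_ring

/-- `‖[x,y] − [x′,y′]‖ ≦ 4aδ` when the four letters have norm `≦ a` and `‖x − x′‖, ‖y − y′‖ ≦ δ`. [folklore] -/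
private theorem norm_comm_sub_comm_le {x y x' y' : 𝔸} {a δ : ℝ} (hx : ‖x‖ ≤ a) (hy : ‖y‖ ≤ a) (hx' : ‖x'‖ ≤ a)
    (hy' : ‖y'‖ ≤ a) (hdx : ‖x - x'‖ ≤ δ) (hdy : ‖y - y'‖ ≤ δ) :
    ‖(x * y - y * x) - (x' * y' - y' * x')‖ ≤ 4 * a * δ := by
  have ha : 0 ≤ a := (norm_nonneg x).trans hx
  have hδ : 0 ≤ δ := (norm_nonneg _).trans hdx
  rw [comm_sub_comm]
  have e1 : ‖(x - x') * y‖ ≤ δ * a := (norm_mul_le _ _).trans (mul_le_mul hdx hy (norm_nonneg _) hδ)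
  have e2 : ‖x' * (y - y')‖ ≤ a * δ := (norm_mul_le _ _).trans (mul_le_mul hx' hdy (norm_nonneg _) ha)
  have e3 : ‖(y - y') * x‖ ≤ δ * a := (norm_mul_le _ _).trans (mul_le_mul hdy hx (norm_nonneg _) hδ)
  have e4 : ‖y' * (x - x')‖ ≤ a * δ := (norm_mul_le _ _).trans (mul_le_mul hy' hdx (norm_nonneg _) ha)
  calc ‖(x - x') * y + x' * (y - y') - (y - y') * x - y' * (x - x')‖
      ≤ ‖(x - x') * y‖ + ‖x' * (y - y')‖ + ‖(y - y') * x‖ + ‖y' * (x - x')‖ :=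
        (norm_sub_le _ _).trans (add_le_add ((norm_sub_le _ _).trans (add_le_add (norm_add_le _ _) le_rfl)) le_rfl)
    _ ≤ δ * a + a * δ + δ * a + a * δ := add_le_add (add_le_add (add_le_add e1 e2) e3) e4
    _ = 4 * a * δ := by ring

/-- The six-commutator sum `Σ_{i<j}[x_i,x_j]` of a four-letter word (`TransportVertices.commSum`), DIFFERENCED against a
second word: `≦ 24aδ` when all letters have norm `≦ a` and corresponding letters differ by `≦ δ`. [folklore] -/
private theorem norm_commSum_four_sub_le {x₁ x₂ x₃ x₄ y₁ y₂ y₃ y₄ : 𝔸} {a δ : ℝ}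
    (h₁ : ‖x₁‖ ≤ a) (h₂ : ‖x₂‖ ≤ a) (h₃ : ‖x₃‖ ≤ a) (h₄ : ‖x₄‖ ≤ a)
    (k₁ : ‖y₁‖ ≤ a) (k₂ : ‖y₂‖ ≤ a) (k₃ : ‖y₃‖ ≤ a) (k₄ : ‖y₄‖ ≤ a)
    (d₁ : ‖x₁ - y₁‖ ≤ δ) (d₂ : ‖x₂ - y₂‖ ≤ δ) (d₃ : ‖x₃ - y₃‖ ≤ δ) (d₄ : ‖x₄ - y₄‖ ≤ δ) :
    ‖commSum [x₁, x₂, x₃, x₄] - commSum [y₁, y₂, y₃, y₄]‖ ≤ 24 * a * δ := by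
  rw [commSum_four, commSum_four]
  have e12 := norm_comm_sub_comm_le h₁ h₂ k₁ k₂ d₁ d₂
  have e13 := norm_comm_sub_comm_le h₁ h₃ k₁ k₃ d₁ d₃
  have e14 := norm_comm_sub_comm_le h₁ h₄ k₁ k₄ d₁ d₄
  have e23 := norm_comm_sub_comm_le h₂ h₃ k₂ k₃ d₂ d₃
  have e24 := norm_comm_sub_comm_le h₂ h₄ k₂ k₄ d₂ d₄
  have e34 := norm_comm_sub_comm_le h₃ h₄ k₃ k₄ d₃ d₄
  have hsplit : ∀ (p₁ p₂ p₃ p₄ p₅ p₆ q₁ q₂ q₃ q₄ q₅ q₆ : 𝔸),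
      (p₁ + p₂ + p₃ + p₄ + p₅ + p₆) - (q₁ + q₂ + q₃ + q₄ + q₅ + q₆)
        = (p₁ - q₁) + (p₂ - q₂) + (p₃ - q₃) + (p₄ - q₄) + (p₅ - q₅) + (p₆ - q₆) := by
    intros; abel
  rw [hsplit]
  refine (norm_add₆_le _ _ _ _ _ _).trans ?_
  linarith

end Elementary

/-! ## §2  The plaquette word of a pure fluctuation `U = e^{iηA}` — the axial/local gauge of (3.35) -/

section Word

variable {𝔸 : Type*} [NormedRing 𝔸] [NormedAlgebra ℂ 𝔸] [CompleteSpace 𝔸] {S : Type*} {ι : Type*}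
variable (T : ι → Equiv.Perm S)

/-- The four letters of the plaquette `p = p_{μν}(x)` read along `∂p = ⟨x, x+e_μ⟩⟨x+e_μ, z⟩⟨z, x+e_ν⟩⟨x+e_ν, x⟩` for the
configuration `U = e^{iηA}` of (3.35) («U^u = e^{iηA}»): `[A_μ(x), A_ν(x+e_μ), −A_μ(x+e_ν), −A_ν(x)]` (reversed bonds carry
`−A`, (3.5)).  With these letters `U(∂p) = Π e^{iη·letter}` (`plaqU_fluct`). [folklore]
[cite: Balaban1985BackgroundPropagators, (3.35) p.396, (3.1) p.390, (3.5) p.391] -/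
def word (A : ι → S → 𝔸) (μ ν : ι) (x : S) : List 𝔸 := [A μ x, A ν (T μ x), -(A μ (T ν x)), -(A ν x)]

omit [NormedAlgebra ℂ 𝔸] [CompleteSpace 𝔸] in
/-- The letter sum is the FLAT curl `(∂¹A)(p) = A_μ(x) + A_ν(x+e_μ) − A_μ(x+e_ν) − A_ν(x)` — the `D¹_U A` of (3.4) at the
trivial background `U ≡ 1`. [folklore] [cite: Balaban1985BackgroundPropagators, (3.4) p.391] -/
theorem word_sum (A : ι → S → 𝔸) (μ ν : ι) (x : S) :
    (word T A μ ν x).sum = curl T (fun _ _ => (1 : 𝔸ˣ)) A μ ν x := by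
  simp only [word, List.sum_cons, List.sum_nil, curl, covD, R_one]
  abel

omit [NormedAlgebra ℂ 𝔸] [CompleteSpace 𝔸] in
/-- The size of the word is the sum of the four letter norms (the «|A|» of (3.35) enters through it). [folklore]
[cite: Balaban1985BackgroundPropagators, (3.35) p.396, (3.1) p.390] -/
theorem size_word (A : ι → S → 𝔸) (μ ν : ι) (x : S) :
    size (word T A μ ν x) = ‖A μ x‖ + ‖A ν (T μ x)‖ + ‖A μ (T ν x)‖ + ‖A ν x‖ := by
  simp only [word, size_cons, size_nil, norm_neg]
  ring

/-- **`U(∂p)` for `U = e^{iηA}` is the ordered exponential of the word** — `e^{iηA_μ(x)}e^{iηA_ν(x+e_μ)}e^{−iηA_μ(x+e_ν)}e^{−iηA_ν(x)}`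
(`B9Eq39Adjoint.fluct`, `B9Eq37Insertion.holU`/`letters`). [folklore] [cite: Balaban1985BackgroundPropagators, (3.1) p.390, (3.35) p.396] -/
theorem plaqU_fluct (η : ℝ) (A : ι → S → 𝔸) (μ ν : ι) (x : S) :
    plaqU T (fluct η A) μ ν x = holU (letters η (word T A μ ν x)) := by
  ext
  simp only [plaqU, Units.val_mul, val_fluct, val_inv_fluct, val_holU, letters, word, List.map_cons, List.map_nil,
    holonomy_cons, holonomy_nil, smul_neg, mul_one, mul_assoc]

omit [NormedAlgebra ℂ 𝔸] [CompleteSpace 𝔸] in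
/-- At equal directions the plaquette variable is trivial: `U(∂p_{μμ}(x)) = 1`. [folklore]
[cite: Balaban1985BackgroundPropagators, (3.1) p.390] -/
theorem plaqU_self (U : ι → S → 𝔸ˣ) (μ : ι) (x : S) : plaqU T U μ μ x = 1 := by
  simp [plaqU]

end Word

/-! ## §3  `Im` of an ordered exponential to second order: `Im Πe^{a_k} = −(i/2)(2Σa_k + Σ_{j<k}[a_j,a_k]) + O(3)` -/

section Holonomy

variable {𝔸 : Type*} [NormedRing 𝔸] [NormedAlgebra ℂ 𝔸] [CompleteSpace 𝔸]

omit [CompleteSpace 𝔸] in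
/-- `Πe^{a_k} − Πe^{−a_k}(reversed) = 2Σa_k + Σ_{j<k}[a_j,a_k] + (E − E′)` EXACTLY, `E`, `E′` the third-order remainders of
`B9Eq37Insertion.rem` along the path and the inverse path: the quadratic `(Σa_k)²` terms cancel, the commutator terms ADD
(`quad_eq_half`, `quad_invPath_eq_half`). [folklore] [cite: Balaban1985BackgroundPropagators, (3.6)–(3.7) p.391] -/
theorem holonomy_sub_holonomy_invPath (l : List 𝔸) :
    holonomy l - holonomy (invPath l) = (2 : ℂ) • l.sum + commSum l + (rem l - rem (invPath l)) := by
  have h1 : holonomy l = 1 + l.sum + quad ℂ l + rem l := by rw [rem]; abel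
  have h2 : holonomy (invPath l) = 1 + (invPath l).sum + quad ℂ (invPath l) + rem (invPath l) := by rw [rem]; abel
  have hc : (2 : ℂ)⁻¹ • commSum l + (2 : ℂ)⁻¹ • commSum l = commSum l := by
    rw [← add_smul, ← two_mul, mul_inv_cancel₀ (two_ne_zero (α := ℂ)), one_smul]
  rw [h1, h2, quad_eq_half, quad_invPath_eq_half, sum_inv, smul_add, smul_sub, two_smul]
  calc 1 + l.sum + ((2 : ℂ)⁻¹ • (l.sum * l.sum) + (2 : ℂ)⁻¹ • commSum l) + rem l
        - (1 + -l.sum + ((2 : ℂ)⁻¹ • (l.sum * l.sum) - (2 : ℂ)⁻¹ • commSum l) + rem (invPath l))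
      = l.sum + l.sum + ((2 : ℂ)⁻¹ • commSum l + (2 : ℂ)⁻¹ • commSum l) + (rem l - rem (invPath l)) := by abel
    _ = l.sum + l.sum + commSum l + (rem l - rem (invPath l)) := by rw [hc]

/-- **`Im` OF THE PLAQUETTE WORD TO SECOND ORDER** (complexified `Im` of p. 391, `B9Eq37Insertion.imC`): for letters `iη·A_k`,
`Im Π_k e^{iηA_k} = η·ΣA_k + (i/2)η²·Σ_{j<k}[A_j,A_k] − (i/2)(E − E′)` exactly, `E`, `E′` third order. [folklore]
[cite: Balaban1985BackgroundPropagators, p.391, (3.6)–(3.7) p.391] -/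
theorem imC_holU_letters (η : ℝ) (l : List 𝔸) :
    imC (holU (letters η l)) = (η : ℂ) • l.sum + ((I / 2) * (η : ℂ) ^ 2) • commSum l
      + (-(I / 2)) • (rem (letters η l) - rem (invPath (letters η l))) := by
  rw [imC_eq, val_holU, val_inv_holU, holonomy_sub_holonomy_invPath, sum_letters, commSum_letters]
  have hI : I * I = -1 := Complex.I_mul_I
  have h1 : (-(I / 2)) * ((2 : ℂ) * (I * (η : ℂ))) = (η : ℂ) := by linear_combination (-(η : ℂ)) * hI
  have h2 : (-(I / 2)) * (-(η : ℂ) ^ 2) = I / 2 * (η : ℂ) ^ 2 := by ring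
  simp only [smul_add, smul_smul]
  rw [h1, h2]

end Holonomy

/-! ## §4  The plaquette function `η⁻²Im U(∂p)` of `U = e^{iηA}`: `= (∂^ηA)(p) + (i/2)Σ_{b₁≺b₂}[A(b₁),A(b₂)] + ρ_p` -/

section PlaquetteFunction

variable {𝔸 : Type*} [NormedRing 𝔸] [NormedAlgebra ℂ 𝔸] [CompleteSpace 𝔸] {S : Type*} {ι : Type*}
variable (T : ι → Equiv.Perm S)

/-- The third-order remainder `ρ_p = −(i/2)η⁻²(E − E′)` of the plaquette function of `U = e^{iηA}` at `p = p_{μν}(x)`. [folklore]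
[cite: Balaban1985BackgroundPropagators, (3.11) p.392, (3.6)–(3.7) p.391] -/
def rho (η : ℝ) (A : ι → S → 𝔸) (μ ν : ι) (x : S) : 𝔸 :=
  (-(I / 2) * ((η : ℂ)⁻¹) ^ 2) • (rem (letters η (word T A μ ν x)) - rem (invPath (letters η (word T A μ ν x))))

/-- **THE PLAQUETTE FUNCTION OF (3.11) FOR `U = e^{iηA}`, TO SECOND ORDER, EXACTLY**:
`η⁻²Im U(∂p) = (∂^ηA)(p) + (i/2)·Σ_{j<k}[A_j,A_k] + ρ_p`, with `∂^η` the FLAT curl (`curlη` at `U ≡ 1`), the commutator sum over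
the word of `p`, and `ρ_p` third order (`norm_rho_le`). [folklore] [cite: Balaban1985BackgroundPropagators, (3.11) p.392, (3.4) p.391] -/
theorem imC_plaqU_fluct {η : ℝ} (hη : η ≠ 0) (A : ι → S → 𝔸) (μ ν : ι) (x : S) :
    (((η : ℂ)⁻¹) ^ 2) • imC (plaqU T (fluct η A) μ ν x)
      = curlη T (fun _ _ => (1 : 𝔸ˣ)) η A μ ν x + (I / 2) • commSum (word T A μ ν x) + rho T η A μ ν x := by
  rw [plaqU_fluct, imC_holU_letters, smul_add, smul_add, smul_smul, smul_smul, smul_smul, word_sum, curlη, rho]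
  have hη' : (η : ℂ) ≠ 0 := Complex.ofReal_ne_zero.mpr hη
  have h1 : ((η : ℂ)⁻¹) ^ 2 * (η : ℂ) = (η : ℂ)⁻¹ := by field_simp
  have h2 : ((η : ℂ)⁻¹) ^ 2 * (I / 2 * (η : ℂ) ^ 2) = I / 2 := by field_simp
  have h3 : ((η : ℂ)⁻¹) ^ 2 * (-(I / 2)) = -(I / 2) * ((η : ℂ)⁻¹) ^ 2 := by ring
  rw [h1, h2, h3]

/-- `‖ρ_p‖ ≦ η·s³e^{ηs}/6` when the word has size `≦ s`: THIRD ORDER, and carrying a factor `η` — so its lattice DIFFERENCE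
quotient `η⁻¹(ρ_{p′} − ρ_p)` needs no cancellation. [folklore] [cite: Balaban1985BackgroundPropagators, (3.6)–(3.7) p.391] -/
theorem norm_rho_le {η : ℝ} (hη : 0 < η) (A : ι → S → 𝔸) (μ ν : ι) (x : S) {s : ℝ}
    (hs : size (word T A μ ν x) ≤ s) :
    ‖rho T η A μ ν x‖ ≤ η * s ^ 3 * Real.exp (η * s) / 6 := by
  have hsz : 0 ≤ size (word T A μ ν x) := size_nonneg _
  obtain ⟨hr, hr'⟩ := norm_rem_letters_le η (word T A μ ν x)
  rw [abs_of_pos hη] at hr hr'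
  have hm : (η * size (word T A μ ν x)) ^ 3 / 6 * Real.exp (η * size (word T A μ ν x))
      ≤ (η * s) ^ 3 / 6 * Real.exp (η * s) := by
    have h1 : η * size (word T A μ ν x) ≤ η * s := mul_le_mul_of_nonneg_left hs hη.le
    have h2 : 0 ≤ η * size (word T A μ ν x) := mul_nonneg hη.le hsz
    have h3 : (η * size (word T A μ ν x)) ^ 3 / 6 ≤ (η * s) ^ 3 / 6 :=
      div_le_div_of_nonneg_right (pow_le_pow_left₀ h2 h1 3) (by norm_num)
    exact mul_le_mul h3 (Real.exp_le_exp.mpr h1) (Real.exp_pos _).le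
      ((div_nonneg (pow_nonneg h2 3) (by norm_num)).trans h3)
  have hR : ‖rem (letters η (word T A μ ν x)) - rem (invPath (letters η (word T A μ ν x)))‖
      ≤ 2 * ((η * s) ^ 3 / 6 * Real.exp (η * s)) :=
    (norm_sub_le _ _).trans (by linarith [hr.trans hm, hr'.trans hm])
  have hscal : ‖(-(I / 2) * ((η : ℂ)⁻¹) ^ 2 : ℂ)‖ = 2⁻¹ * (η ^ 2)⁻¹ := by
    rw [norm_mul, norm_neg, norm_div, Complex.norm_I, Complex.norm_two, norm_pow, norm_inv, Complex.norm_real,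
      Real.norm_eq_abs, abs_of_pos hη, one_div, inv_pow]
  rw [rho, norm_smul, hscal]
  refine (mul_le_mul_of_nonneg_left hR (by positivity)).trans (le_of_eq ?_)
  field_simp

omit [CompleteSpace 𝔸] in
/-- `|(∂^ηA)(p_{μν}(x))| ≦ η⁻¹(|(∂¹_μA_ν)(x)| + |(∂¹_νA_μ)(x)|)`: the flat curl through the two unit-lattice differences
(`covD` at `U ≡ 1` is `A_ν(x+e_μ) − A_ν(x)`). [folklore] [cite: Balaban1985BackgroundPropagators, (3.4) p.391, (3.35) p.396] -/
theorem norm_curlη_one_le {η : ℝ} (hη : 0 < η) (A : ι → S → 𝔸) (μ ν : ι) (x : S) :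
    ‖curlη T (fun _ _ => (1 : 𝔸ˣ)) η A μ ν x‖
      ≤ η⁻¹ * (‖covD T (fun _ _ => (1 : 𝔸ˣ)) μ (A ν) x‖ + ‖covD T (fun _ _ => (1 : 𝔸ˣ)) ν (A μ) x‖) := by
  rw [curlη, norm_smul, norm_inv, Complex.norm_real, Real.norm_eq_abs, abs_of_pos hη, curl]
  exact mul_le_mul_of_nonneg_left (norm_sub_le _ _) (inv_nonneg.mpr hη.le)

/-- **SIZE OF THE PLAQUETTE FUNCTION** `|η⁻²Im U(∂p)| ≦ η⁻¹(g₁ + g₂) + s²/2 + ηs³e^{ηs}/6` from the word size `s` and the two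
unit-lattice differences `g₁, g₂` entering `(∂^ηA)(p)` (`‖Σ_{j<k}[A_j,A_k]‖ ≦ s²`, `TransportVertices.norm_commSum_le`). [folklore]
[cite: Balaban1985BackgroundPropagators, (3.11) p.392, (3.35) p.396] -/
theorem norm_F_le {η : ℝ} (hη : 0 < η) (A : ι → S → 𝔸) (μ ν : ι) (x : S) {s g₁ g₂ : ℝ}
    (hs : size (word T A μ ν x) ≤ s) (hg₁ : ‖covD T (fun _ _ => (1 : 𝔸ˣ)) μ (A ν) x‖ ≤ g₁)
    (hg₂ : ‖covD T (fun _ _ => (1 : 𝔸ˣ)) ν (A μ) x‖ ≤ g₂) :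
    ‖(((η : ℂ)⁻¹) ^ 2) • imC (plaqU T (fluct η A) μ ν x)‖
      ≤ η⁻¹ * (g₁ + g₂) + s ^ 2 / 2 + η * s ^ 3 * Real.exp (η * s) / 6 := by
  rw [imC_plaqU_fluct T hη.ne']
  have h1 : ‖curlη T (fun _ _ => (1 : 𝔸ˣ)) η A μ ν x‖ ≤ η⁻¹ * (g₁ + g₂) :=
    (norm_curlη_one_le T hη A μ ν x).trans (mul_le_mul_of_nonneg_left (add_le_add hg₁ hg₂) (inv_nonneg.mpr hη.le))
  have h2 : ‖(I / 2 : ℂ) • commSum (word T A μ ν x)‖ ≤ s ^ 2 / 2 := by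
    rw [norm_smul, norm_div, Complex.norm_I, Complex.norm_two]
    have hc := norm_commSum_le (word T A μ ν x)
    have hsq : size (word T A μ ν x) ^ 2 ≤ s ^ 2 := pow_le_pow_left₀ (size_nonneg _) hs 2
    linarith
  have h3 := norm_rho_le T hη A μ ν x hs
  exact (norm_add₃_le).trans (by linarith)

end PlaquetteFunction

/-! ## §5  The current `J = D*η⁻²Im ∂U` of (3.11) for `U = e^{iηA}`: decomposition into `∂^{η*}∂^ηA` + corrections -/

section Current

variable {𝔸 : Type*} [NormedRing 𝔸] [NormedAlgebra ℂ 𝔸] [CompleteSpace 𝔸] {S : Type*} {ι : Type*}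
variable (T : ι → Equiv.Perm S)

omit [NormedAlgebra ℂ 𝔸] [CompleteSpace 𝔸] in
/-- `D*_ν` at the TRIVIAL background is the plain backward difference `(D*_{1,ν}G)(x) = G(x − e_ν) − G(x)` ((3.8) at `U ≡ 1`,
unit lattice). [folklore] [cite: Balaban1985BackgroundPropagators, (3.8) p.392] -/
theorem covDstar_one (ν : ι) (G : S → 𝔸) (x : S) :
    covDstar T (fun _ _ => (1 : 𝔸ˣ)) ν G x = G ((T ν).symm x) - G x := by
  simp [covDstar]

/-- **`D*_ν` OF `U = e^{iηA}` = FLAT `D*_ν` + TRANSPORT CORRECTION**: with `y = x − e_ν`,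
`(D*_{U,ν}G)(x) = (D*_{1,ν}G)(x) + (e^{−iηA_ν(y)}G(y)e^{iηA_ν(y)} − G(y))` ((3.8) with (3.5): `U(x, x−e_ν) = U_ν(y)⁻¹`).
[folklore] [cite: Balaban1985BackgroundPropagators, (3.8) p.392, (3.5) p.391] -/
theorem covDstar_fluct (η : ℝ) (A : ι → S → 𝔸) (ν : ι) (G : S → 𝔸) (x : S) :
    covDstar T (fluct η A) ν G x
      = covDstar T (fun _ _ => (1 : 𝔸ˣ)) ν G x
        + (exp (-(((I * η : ℂ)) • A ν ((T ν).symm x))) * G ((T ν).symm x) * exp (((I * η : ℂ)) • A ν ((T ν).symm x))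
            - G ((T ν).symm x)) := by
  simp only [covDstar, R_def, inv_inv, val_inv_fluct, val_fluct, inv_one, Units.val_one, one_mul, mul_one]
  abel

/-- … hence `‖(D*_{U,ν}G)(x) − (D*_{1,ν}G)(x)‖ ≦ (e^{2η|A_ν(y)|} − 1)|G(y)|` (`B9Eq370Expansion.norm_conj_sub_le` BY NAME).
[folklore] [cite: Balaban1985BackgroundPropagators, (3.8) p.392, p.405] -/
theorem norm_covDstar_fluct_sub_le {η : ℝ} (hη : 0 ≤ η) (A : ι → S → 𝔸) (ν : ι) (G : S → 𝔸) (x : S) :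
    ‖covDstar T (fluct η A) ν G x - covDstar T (fun _ _ => (1 : 𝔸ˣ)) ν G x‖
      ≤ (Real.exp (2 * (η * ‖A ν ((T ν).symm x)‖)) - 1) * ‖G ((T ν).symm x)‖ := by
  rw [covDstar_fluct, add_sub_cancel_left]
  have h := norm_conj_sub_le (-(((I * η : ℂ)) • A ν ((T ν).symm x))) (G ((T ν).symm x))
  rw [neg_neg, norm_neg, norm_Iη_smul hη] at h
  exact h

variable [Fintype ι] [LinearOrder ι]

omit [CompleteSpace 𝔸] in
/-- **(3.11) WITH (3.9), LAST FORM**: `J_μ(x) = η⁻¹ Σ_ν (D*_ν F_{νμ})(x)` with `F(p) = η⁻²Im U(∂p)` — antisymmetry of `F`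
(`imC_plaqU_swap`) turns the first form of (3.9) into the last. [folklore]
[cite: Balaban1985BackgroundPropagators, (3.11) p.392, (3.9) p.392] -/
theorem J_eq_sum (U : ι → S → 𝔸ˣ) (η : ℝ) (μ : ι) (x : S) :
    J T U η μ x
      = ((η : ℂ)⁻¹) • ∑ ν, covDstar T U ν (fun y => (((η : ℂ)⁻¹) ^ 2) • imC (plaqU T U ν μ y)) x := by
  have hJ : J T U η μ x
      = ((η : ℂ)⁻¹) • divP T U (fun κ ν y => (((η : ℂ)⁻¹) ^ 2) • imC (plaqU T U κ ν y)) μ x := rfl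
  rw [hJ, divP_eq_sum_of_antisymm']
  intro κ ν y
  simp only [imC_plaqU_swap T U κ ν y, smul_neg]

omit [CompleteSpace 𝔸] in
/-- `(D^{η*}D^ηA)_μ(x) = η⁻¹ Σ_ν (D*_ν (D^ηA)_{νμ})(x)` — (3.9), last form, for the curl (any background). [folklore]
[cite: Balaban1985BackgroundPropagators, (3.9) p.392, (3.10) p.392] -/
theorem divPη_curlη_eq_sum (U : ι → S → 𝔸ˣ) (η : ℝ) (A : ι → S → 𝔸) (μ : ι) (x : S) :
    divPη T U η (curlη T U η A) μ x = ((η : ℂ)⁻¹) • ∑ ν, covDstar T U ν (curlη T U η A ν μ) x := by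
  rw [divPη, divP_eq_sum_of_antisymm']
  intro κ ν y
  rw [curlη, curlη, curl_swap T U A κ ν y, smul_neg]

/-- **THE DECOMPOSITION OF THE CURRENT OF `U = e^{iηA}`**:
`J_μ(x) = (∂^{η*}∂^ηA)_μ(x) + η⁻¹ Σ_ν [T_ν + (i/2)(C(p′_ν) − C(p_ν)) + (ρ_{p′_ν} − ρ_{p_ν})]`, where `p_ν = p_{νμ}(x)`,
`p′_ν = p_{νμ}(x − e_ν)`, `T_ν` = the transport correction of `D*_ν` (`covDstar_fluct`), `C` = the commutator sum of the word,
`ρ` = the third-order remainder — the flat part `∂^{η*}∂^ηA` is the object of (3.36). [folklore]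
[cite: Balaban1985BackgroundPropagators, (3.11) p.392, (3.36) p.396] -/
theorem J_fluct_decomp {η : ℝ} (hη : η ≠ 0) (A : ι → S → 𝔸) (μ : ι) (x : S) :
    J T (fluct η A) η μ x
      = divPη T (fun _ _ => (1 : 𝔸ˣ)) η (curlη T (fun _ _ => (1 : 𝔸ˣ)) η A) μ x
        + ((η : ℂ)⁻¹) • ∑ ν,
            ((covDstar T (fluct η A) ν (fun z => (((η : ℂ)⁻¹) ^ 2) • imC (plaqU T (fluct η A) ν μ z)) x
                - covDstar T (fun _ _ => (1 : 𝔸ˣ)) ν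
                    (fun z => (((η : ℂ)⁻¹) ^ 2) • imC (plaqU T (fluct η A) ν μ z)) x)
              + ((I / 2 : ℂ) • (commSum (word T A ν μ ((T ν).symm x)) - commSum (word T A ν μ x))
                + (rho T η A ν μ ((T ν).symm x) - rho T η A ν μ x))) := by
  rw [J_eq_sum, divPη_curlη_eq_sum, ← smul_add, ← Finset.sum_add_distrib]
  congr 1
  refine Finset.sum_congr rfl fun ν _ => ?_
  simp only [covDstar_one, imC_plaqU_fluct T hη, smul_sub]
  abel

omit [Fintype ι] [LinearOrder ι] in
/-- At `ν = μ` the summand of `J_fluct_decomp` vanishes (`U(∂p_{μμ}) = 1`). [folklore]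
[cite: Balaban1985BackgroundPropagators, (3.11) p.392] -/
theorem summand_self_eq_zero {η : ℝ} (hη : η ≠ 0) (A : ι → S → 𝔸) (μ : ι) (x : S) :
    (covDstar T (fluct η A) μ (fun z => (((η : ℂ)⁻¹) ^ 2) • imC (plaqU T (fluct η A) μ μ z)) x
          - covDstar T (fun _ _ => (1 : 𝔸ˣ)) μ (fun z => (((η : ℂ)⁻¹) ^ 2) • imC (plaqU T (fluct η A) μ μ z)) x)
        + ((I / 2 : ℂ) • (commSum (word T A μ μ ((T μ).symm x)) - commSum (word T A μ μ x))
          + (rho T η A μ μ ((T μ).symm x) - rho T η A μ μ x)) = 0 := by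
  have hF : (fun z => (((η : ℂ)⁻¹) ^ 2) • imC (plaqU T (fluct η A) μ μ z)) = 0 := by
    funext z
    rw [plaqU_self, imC_one, smul_zero, Pi.zero_apply]
  have hz : ∀ z, (I / 2 : ℂ) • commSum (word T A μ μ z) + rho T η A μ μ z = 0 := by
    intro z
    have h := imC_plaqU_fluct T hη A μ μ z
    rw [plaqU_self, imC_one, smul_zero, curlη, curl_self, smul_zero, zero_add] at h
    exact h.symm
  rw [hF, covDstar_zero, covDstar_zero, sub_zero, zero_add, smul_sub]
  have h1 := hz ((T μ).symm x)
  have h2 := hz x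
  calc (I / 2 : ℂ) • commSum (word T A μ μ ((T μ).symm x)) - (I / 2 : ℂ) • commSum (word T A μ μ x)
        + (rho T η A μ μ ((T μ).symm x) - rho T η A μ μ x)
      = ((I / 2 : ℂ) • commSum (word T A μ μ ((T μ).symm x)) + rho T η A μ μ ((T μ).symm x))
          - ((I / 2 : ℂ) • commSum (word T A μ μ x) + rho T η A μ μ x) := by abel
    _ = 0 := by rw [h1, h2, sub_zero]

end Current

/-! ## §6  THE ESTIMATE: (3.35)–(3.36) ⟹ `|J(b)| ≦ O(1)·Mα₀·(Lʲη)⁻³` in the gauge `U = e^{iηA}` -/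

section Estimate

variable {𝔸 : Type*} [NormedRing 𝔸] [NormedAlgebra ℂ 𝔸] [CompleteSpace 𝔸] {S : Type*} {ι : Type*}
variable (T : ι → Equiv.Perm S)

/-- The per-direction error budget `B(η, a, g)` of the estimate: transport × plaquette-function size, commutator difference
`12ag`, and twice the third-order remainder — for letter bound `a = sup|A|` and unit-lattice difference bound
`g = η·sup|∇^ηA|`. [folklore] [cite: Balaban1985BackgroundPropagators, (3.35)–(3.36) p.396, (3.11) p.392] -/
def errB (η a g : ℝ) : ℝ :=
  (Real.exp (2 * (η * a)) - 1) * (η⁻¹ * (g + g) + (4 * a) ^ 2 / 2 + η * (4 * a) ^ 3 * Real.exp (η * (4 * a)) / 6)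
    + 12 * a * g + 2 * (η * (4 * a) ^ 3 * Real.exp (η * (4 * a)) / 6)

/-- Unfolding `errB`. [folklore] [cite: Balaban1985BackgroundPropagators, (3.35)–(3.36) p.396] -/
theorem errB_def (η a g : ℝ) : errB η a g
    = (Real.exp (2 * (η * a)) - 1) * (η⁻¹ * (g + g) + (4 * a) ^ 2 / 2 + η * (4 * a) ^ 3 * Real.exp (η * (4 * a)) / 6)
      + 12 * a * g + 2 * (η * (4 * a) ^ 3 * Real.exp (η * (4 * a)) / 6) := rfl

variable [Fintype ι] [LinearOrder ι]

omit [Fintype ι] [LinearOrder ι] in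
/-- **THE PER-DIRECTION ERROR TERM IS `≦ B(η,a,g)`** — pointwise hypotheses: the seven letters of the two plaquettes
`p_{νμ}(x)`, `p_{νμ}(x − e_ν)` have norm `≦ a`; the five unit-lattice differences of `A` that enter (four letter
differences, one more for the curl at `x − e_ν`) have norm `≦ g`; commuting shifts (the plaquettes close, p. 391). [folklore]
[cite: Balaban1985BackgroundPropagators, (3.35)–(3.36) p.396, (3.11) p.392, p.391] -/
theorem norm_summand_le (hT : ∀ μ ν x, T μ (T ν x) = T ν (T μ x)) {η : ℝ} (hη : 0 < η) (A : ι → S → 𝔸)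
    (μ ν : ι) (x : S) {a g : ℝ}
    (h₁ : ‖A ν x‖ ≤ a) (h₂ : ‖A μ (T ν x)‖ ≤ a) (h₃ : ‖A ν (T μ x)‖ ≤ a) (h₄ : ‖A μ x‖ ≤ a)
    (h₅ : ‖A ν ((T ν).symm x)‖ ≤ a) (h₆ : ‖A ν (T μ ((T ν).symm x))‖ ≤ a) (h₇ : ‖A μ ((T ν).symm x)‖ ≤ a)
    (d₁ : ‖covD T (fun _ _ => (1 : 𝔸ˣ)) ν (A ν) ((T ν).symm x)‖ ≤ g)
    (d₂ : ‖covD T (fun _ _ => (1 : 𝔸ˣ)) ν (A μ) x‖ ≤ g)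
    (d₃ : ‖covD T (fun _ _ => (1 : 𝔸ˣ)) ν (A ν) (T μ ((T ν).symm x))‖ ≤ g)
    (d₄ : ‖covD T (fun _ _ => (1 : 𝔸ˣ)) ν (A μ) ((T ν).symm x)‖ ≤ g)
    (d₅ : ‖covD T (fun _ _ => (1 : 𝔸ˣ)) μ (A ν) ((T ν).symm x)‖ ≤ g) :
    ‖(covDstar T (fluct η A) ν (fun z => (((η : ℂ)⁻¹) ^ 2) • imC (plaqU T (fluct η A) ν μ z)) x
          - covDstar T (fun _ _ => (1 : 𝔸ˣ)) ν (fun z => (((η : ℂ)⁻¹) ^ 2) • imC (plaqU T (fluct η A) ν μ z)) x)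
        + ((I / 2 : ℂ) • (commSum (word T A ν μ ((T ν).symm x)) - commSum (word T A ν μ x))
          + (rho T η A ν μ ((T ν).symm x) - rho T η A ν μ x))‖ ≤ errB η a g := by
  set y := (T ν).symm x with hy
  have hTy : T ν y = x := by rw [hy]; exact (T ν).apply_symm_apply x
  have hTμy : T ν (T μ y) = T μ x := by rw [hT, hTy]
  have ha : 0 ≤ a := (norm_nonneg _).trans h₁
  have hg : 0 ≤ g := (norm_nonneg _).trans d₂
  have hsx : size (word T A ν μ x) ≤ 4 * a := by
    rw [size_word]; linarith
  have hsy : size (word T A ν μ y) ≤ 4 * a := by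
    rw [size_word, hTy]; linarith
  -- the plaquette function at the shifted plaquette
  have hF : ‖(((η : ℂ)⁻¹) ^ 2) • imC (plaqU T (fluct η A) ν μ y)‖
      ≤ η⁻¹ * (g + g) + (4 * a) ^ 2 / 2 + η * (4 * a) ^ 3 * Real.exp (η * (4 * a)) / 6 :=
    norm_F_le T hη A ν μ y hsy d₄ d₅
  -- T1: the transport correction
  have hT1 : ‖covDstar T (fluct η A) ν (fun z => (((η : ℂ)⁻¹) ^ 2) • imC (plaqU T (fluct η A) ν μ z)) x
        - covDstar T (fun _ _ => (1 : 𝔸ˣ)) ν (fun z => (((η : ℂ)⁻¹) ^ 2) • imC (plaqU T (fluct η A) ν μ z)) x‖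
      ≤ (Real.exp (2 * (η * a)) - 1)
          * (η⁻¹ * (g + g) + (4 * a) ^ 2 / 2 + η * (4 * a) ^ 3 * Real.exp (η * (4 * a)) / 6) := by
    refine (norm_covDstar_fluct_sub_le T hη.le A ν _ x).trans ?_
    have he : Real.exp (2 * (η * ‖A ν y‖)) - 1 ≤ Real.exp (2 * (η * a)) - 1 := by
      gcongr
    have he0 : 0 ≤ Real.exp (2 * (η * ‖A ν y‖)) - 1 := by
      have h0 : 0 ≤ 2 * (η * ‖A ν y‖) := by positivity
      linarith [Real.add_one_le_exp (2 * (η * ‖A ν y‖))]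
    exact mul_le_mul he hF (norm_nonneg _) (he0.trans he)
  -- T2: the commutator difference (product rule)
  have hT2 : ‖(I / 2 : ℂ) • (commSum (word T A ν μ y) - commSum (word T A ν μ x))‖ ≤ 12 * a * g := by
    rw [norm_smul, norm_div, Complex.norm_I, Complex.norm_two]
    have hc : ‖commSum (word T A ν μ y) - commSum (word T A ν μ x)‖ ≤ 24 * a * g := by
      simp only [word, hTy]
      refine norm_commSum_four_sub_le h₅ h₄ ?_ ?_ h₁ h₂ ?_ ?_ ?_ ?_ ?_ ?_
      · rw [norm_neg]; exact h₆
      · rw [norm_neg]; exact h₇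
      · rw [norm_neg]; exact h₃
      · rw [norm_neg]; exact h₄
      · rw [← norm_neg, neg_sub]; simpa [covD, hTy] using d₁
      · rw [← norm_neg, neg_sub]; simpa [covD] using d₂
      · rw [neg_sub_neg]; simpa [covD, hTμy] using d₃
      · rw [neg_sub_neg]; simpa [covD, hTy] using d₄
    linarith
  -- T3: the remainder difference, no cancellation needed
  have hT3 : ‖rho T η A ν μ y - rho T η A ν μ x‖ ≤ 2 * (η * (4 * a) ^ 3 * Real.exp (η * (4 * a)) / 6) := by
    have r1 := norm_rho_le T hη A ν μ y hsy
    have r2 := norm_rho_le T hη A ν μ x hsx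
    exact (norm_sub_le _ _).trans (by linarith)
  have hsum := (norm_add_le _ _).trans (add_le_add hT1 ((norm_add_le _ _).trans (add_le_add hT2 hT3)))
  rw [errB_def]
  linarith

/-- **(3.35)–(3.36) ⟹ `|J(b)| ≦ |∂^{η*}∂^ηA(b)| + (d − 1)η⁻¹B(η,a,g)`, LOCAL FORM.**  In the gauge of (3.35) (`U = e^{iηA}`
on the abstract lattice), for a bond `b = ⟨x, x+e_μ⟩` whose current stencil — `x`, `x + e_κ` (all `κ`), `x − e_ν`,
`x − e_ν + e_μ` (all `ν`) — lies in a site set `N` («on □») on which `|A| ≦ a` and the unit-lattice differences of `A` are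
`≦ g` (= `η·|∇^ηA|`), and with `|(∂^{η*}∂^ηA)_μ(x)| ≦ t` ((3.36) at `b`):
`|J_μ(x)| ≦ t + (|ι| − 1)·η⁻¹·B(η, a, g)`. [folklore]
[cite: Balaban1985BackgroundPropagators, (3.35)–(3.36) p.396, (3.11) p.392, p.422] -/
theorem norm_J_fluct_le_local (hT : ∀ μ ν x, T μ (T ν x) = T ν (T μ x)) {η : ℝ} (hη : 0 < η)
    (A : ι → S → 𝔸) (N : Set S) {a g t : ℝ} (μ : ι) (x : S)
    (hx : x ∈ N) (hN₁ : ∀ κ, T κ x ∈ N) (hN₂ : ∀ ν, (T ν).symm x ∈ N) (hN₃ : ∀ ν, T μ ((T ν).symm x) ∈ N)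
    (hA : ∀ κ, ∀ z ∈ N, ‖A κ z‖ ≤ a)
    (hD : ∀ κ ν, ∀ z ∈ N, ‖covD T (fun _ _ => (1 : 𝔸ˣ)) κ (A ν) z‖ ≤ g)
    (h36 : ‖divPη T (fun _ _ => (1 : 𝔸ˣ)) η (curlη T (fun _ _ => (1 : 𝔸ˣ)) η A) μ x‖ ≤ t) :
    ‖J T (fluct η A) η μ x‖ ≤ t + (Fintype.card ι - 1) * (η⁻¹ * errB η a g) := by
  rw [J_fluct_decomp T hη.ne' A μ x]
  refine (norm_add_le _ _).trans (add_le_add h36 ?_)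
  set E : ι → 𝔸 := fun ν =>
    (covDstar T (fluct η A) ν (fun z => (((η : ℂ)⁻¹) ^ 2) • imC (plaqU T (fluct η A) ν μ z)) x
        - covDstar T (fun _ _ => (1 : 𝔸ˣ)) ν (fun z => (((η : ℂ)⁻¹) ^ 2) • imC (plaqU T (fluct η A) ν μ z)) x)
      + ((I / 2 : ℂ) • (commSum (word T A ν μ ((T ν).symm x)) - commSum (word T A ν μ x))
        + (rho T η A ν μ ((T ν).symm x) - rho T η A ν μ x)) with hE
  have hEμ : E μ = 0 := summand_self_eq_zero T hη.ne' A μ x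
  have hEν : ∀ ν, ‖E ν‖ ≤ errB η a g := fun ν =>
    norm_summand_le T hT hη A μ ν x (hA ν x hx) (hA μ _ (hN₁ ν)) (hA ν _ (hN₁ μ)) (hA μ x hx)
      (hA ν _ (hN₂ ν)) (hA ν _ (hN₃ ν)) (hA μ _ (hN₂ ν)) (hD ν ν _ (hN₂ ν)) (hD ν μ x hx) (hD ν ν _ (hN₃ ν))
      (hD ν μ _ (hN₂ ν)) (hD μ ν _ (hN₂ ν))
  have hcard : (1 : ℕ) ≤ Fintype.card ι := Fintype.card_pos_iff.mpr ⟨μ⟩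
  rw [norm_smul, norm_inv, Complex.norm_real, Real.norm_eq_abs, abs_of_pos hη,
    ← Finset.sum_erase Finset.univ hEμ]
  calc η⁻¹ * ‖∑ ν ∈ Finset.univ.erase μ, E ν‖
      ≤ η⁻¹ * ∑ ν ∈ Finset.univ.erase μ, errB η a g := by
        refine mul_le_mul_of_nonneg_left ((norm_sum_le _ _).trans (Finset.sum_le_sum fun ν _ => hEν ν))
          (inv_nonneg.mpr hη.le)
    _ = (Fintype.card ι - 1) * (η⁻¹ * errB η a g) := by
        rw [Finset.sum_const, Finset.card_erase_of_mem (Finset.mem_univ μ), Finset.card_univ, nsmul_eq_mul,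
          Nat.cast_sub hcard, Nat.cast_one]
        ring

/-- **(3.35)–(3.36) ⟹ `|J(b)| ≦ t + (d − 1)η⁻¹B(η,a,g)`, GLOBAL FORM** (hypotheses on the whole finite lattice, e.g. the torus):
`|A| ≦ a`, unit-lattice differences `≦ g`, `|∂^{η*}∂^ηA| ≦ t` everywhere. [folklore]
[cite: Balaban1985BackgroundPropagators, (3.35)–(3.36) p.396, (3.11) p.392, p.422] -/
theorem norm_J_fluct_le (hT : ∀ μ ν x, T μ (T ν x) = T ν (T μ x)) {η : ℝ} (hη : 0 < η) (A : ι → S → 𝔸)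
    {a g t : ℝ} (hA : ∀ κ z, ‖A κ z‖ ≤ a) (hD : ∀ κ ν z, ‖covD T (fun _ _ => (1 : 𝔸ˣ)) κ (A ν) z‖ ≤ g)
    (h36 : ∀ μ x, ‖divPη T (fun _ _ => (1 : 𝔸ˣ)) η (curlη T (fun _ _ => (1 : 𝔸ˣ)) η A) μ x‖ ≤ t)
    (μ : ι) (x : S) :
    ‖J T (fluct η A) η μ x‖ ≤ t + (Fintype.card ι - 1) * (η⁻¹ * errB η a g) :=
  norm_J_fluct_le_local T hT hη A Set.univ μ x (Set.mem_univ _) (fun _ => Set.mem_univ _)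
    (fun _ => Set.mem_univ _) (fun _ => Set.mem_univ _) (fun κ z _ => hA κ z) (fun κ ν z _ => hD κ ν z) (h36 μ x)

end Estimate

/-! ## §7  The scales of (3.35)–(3.36): `a = ε(Lʲη)⁻¹`, `g = η·ε(Lʲη)⁻²`, `t = ε(Lʲη)⁻³`, `ε = O(1)Mα₀ ≦ 1` -/

section Scaled

/-- **THE REAL-ARITHMETIC BUDGET**: at the scales of (3.35)–(3.36) — letters `a = εξ⁻¹`, unit-lattice differences
`g = η·εξ⁻²` (`ξ = Lʲη ≧ η`), `0 ≦ ε ≦ 1` — the error is `η⁻¹B ≦ 10⁴·ε²ξ⁻³` (`e² ≦ 7.4`, `e⁴ ≦ 54.6`; the print's «O(1)Mα₀ …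
sufficiently small» is `ε ≦ 1` here). [folklore] [cite: Balaban1985BackgroundPropagators, (3.35)–(3.36) p.396] -/
theorem budget {η ξ ε : ℝ} (hη : 0 < η) (hηξ : η ≤ ξ) (hε0 : 0 ≤ ε) (hε1 : ε ≤ 1) :
    η⁻¹ * errB η (ε * ξ⁻¹) (η * (ε * (ξ ^ 2)⁻¹)) ≤ 10 ^ 4 * (ε ^ 2 * (ξ ^ 3)⁻¹) := by
  have hξ0 : 0 < ξ := hη.trans_le hηξ
  have hp0 : 0 < ξ⁻¹ := inv_pos.mpr hξ0
  set p := ξ⁻¹ with hp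
  have hηp : η * p ≤ 1 := by
    rw [hp, mul_inv_le_iff₀ hξ0, one_mul]; exact hηξ
  have hξ2 : (ξ ^ 2)⁻¹ = p ^ 2 := by rw [hp, inv_pow]
  have hξ3 : (ξ ^ 3)⁻¹ = p ^ 3 := by rw [hp, inv_pow]
  rw [hξ2, hξ3]
  have hεp : 0 ≤ ε * p := mul_nonneg hε0 hp0.le
  have hηεp : η * (ε * p) ≤ 1 := by
    have h1 : η * (ε * p) = ε * (η * p) := by ring
    rw [h1]
    calc ε * (η * p) ≤ 1 * 1 := mul_le_mul hε1 hηp (by positivity) zero_le_one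
      _ = 1 := one_mul 1
  have hE2 : Real.exp (2 * (η * (ε * p))) ≤ 7.4 :=
    (Real.exp_le_exp.mpr (by linarith)).trans exp_two_le
  have hE4 : Real.exp (η * (4 * (ε * p))) ≤ 54.6 :=
    (Real.exp_le_exp.mpr (by linarith)).trans exp_four_le
  have hE4pos : 0 < Real.exp (η * (4 * (ε * p))) := Real.exp_pos _
  have hE2sub : Real.exp (2 * (η * (ε * p))) - 1 ≤ 2 * (η * (ε * p)) * 7.4 := by
    have h := exp_sub_one_le_mul_exp (2 * (η * (ε * p)))
    have h0 : 0 ≤ 2 * (η * (ε * p)) := by positivity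
    exact h.trans (mul_le_mul_of_nonneg_left hE2 h0)
  -- rewrite the budget in monomials
  have hfs : η⁻¹ * errB η (ε * p) (η * (ε * p ^ 2))
      = (Real.exp (2 * (η * (ε * p))) - 1) * η⁻¹
          * (2 * (ε * p ^ 2) + 8 * (ε ^ 2 * p ^ 2)
              + 32 / 3 * ((η * p) * (ε ^ 3 * p ^ 2)) * Real.exp (η * (4 * (ε * p))))
        + 12 * (ε ^ 2 * p ^ 3) + 64 / 3 * (ε ^ 3 * p ^ 3) * Real.exp (η * (4 * (ε * p))) := by
    rw [errB_def]
    field_simp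
    ring
  rw [hfs]
  -- the three pieces
  have hq1 : (Real.exp (2 * (η * (ε * p))) - 1) * η⁻¹ ≤ 14.8 * (ε * p) := by
    rw [mul_inv_le_iff₀ hη]
    linarith
  have hε2 : ε ^ 2 ≤ ε := by nlinarith
  have hε3 : ε ^ 3 ≤ ε ^ 2 := by nlinarith
  have hq2 : 2 * (ε * p ^ 2) + 8 * (ε ^ 2 * p ^ 2)
        + 32 / 3 * ((η * p) * (ε ^ 3 * p ^ 2)) * Real.exp (η * (4 * (ε * p))) ≤ 592.4 * (ε * p ^ 2) := by
    have h1 : ε ^ 2 * p ^ 2 ≤ ε * p ^ 2 := mul_le_mul_of_nonneg_right hε2 (by positivity)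
    have h2 : (η * p) * (ε ^ 3 * p ^ 2) * Real.exp (η * (4 * (ε * p))) ≤ 1 * (ε * p ^ 2) * 54.6 := by
      refine mul_le_mul (mul_le_mul hηp ?_ (by positivity) zero_le_one) hE4 hE4pos.le (by positivity)
      exact mul_le_mul_of_nonneg_right (hε3.trans hε2) (by positivity)
    linarith
  have hq3 : ε ^ 3 * p ^ 3 * Real.exp (η * (4 * (ε * p))) ≤ ε ^ 2 * p ^ 3 * 54.6 :=
    mul_le_mul (mul_le_mul_of_nonneg_right hε3 (by positivity)) hE4 hE4pos.le (by positivity)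
  have hq12 : (Real.exp (2 * (η * (ε * p))) - 1) * η⁻¹
        * (2 * (ε * p ^ 2) + 8 * (ε ^ 2 * p ^ 2)
            + 32 / 3 * ((η * p) * (ε ^ 3 * p ^ 2)) * Real.exp (η * (4 * (ε * p))))
      ≤ 14.8 * (ε * p) * (592.4 * (ε * p ^ 2)) := by
    refine mul_le_mul hq1 hq2 (by positivity) (by positivity)
  have hx0 : 0 ≤ ε ^ 2 * p ^ 3 := by positivity
  nlinarith

variable {𝔸 : Type*} [NormedRing 𝔸] [NormedAlgebra ℂ 𝔸] [CompleteSpace 𝔸] {S : Type*} {ι : Type*}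
variable (T : ι → Equiv.Perm S) [Fintype ι] [LinearOrder ι]

/-- **(3.35)–(3.36) ⟹ `|J| ≦ (1 + 10⁴(d−1)ε)·εξ⁻³`** in the gauge `U = e^{iηA}`, hypotheses global on the finite lattice:
`|A| ≦ εξ⁻¹`, `|A(b + e_κ) − A(b)| ≦ η·εξ⁻²` (i.e. `|∇^ηA| ≦ εξ⁻²`), `|∂^{η*}∂^ηA| ≦ εξ⁻³`, `0 < η ≦ ξ`, `0 ≦ ε ≦ 1`.
The leading coefficient is `1`: `J = ∂^{η*}∂^ηA + O(ε)·εξ⁻³`. [folklore]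
[cite: Balaban1985BackgroundPropagators, (3.35)–(3.36) p.396, (3.11) p.392, p.422] -/
theorem norm_J_fluct_le_scaled (hT : ∀ μ ν x, T μ (T ν x) = T ν (T μ x)) {η ξ ε : ℝ} (hη : 0 < η)
    (hηξ : η ≤ ξ) (hε0 : 0 ≤ ε) (hε1 : ε ≤ 1) (A : ι → S → 𝔸)
    (hA : ∀ κ z, ‖A κ z‖ ≤ ε * ξ⁻¹)
    (hD : ∀ κ ν z, ‖covD T (fun _ _ => (1 : 𝔸ˣ)) κ (A ν) z‖ ≤ η * (ε * (ξ ^ 2)⁻¹))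
    (h36 : ∀ μ x, ‖divPη T (fun _ _ => (1 : 𝔸ˣ)) η (curlη T (fun _ _ => (1 : 𝔸ˣ)) η A) μ x‖ ≤ ε * (ξ ^ 3)⁻¹)
    (μ : ι) (x : S) :
    ‖J T (fluct η A) η μ x‖ ≤ (1 + 10 ^ 4 * (Fintype.card ι - 1) * ε) * (ε * (ξ ^ 3)⁻¹) := by
  have h := norm_J_fluct_le T hT hη A hA hD h36 μ x
  have hb := budget hη hηξ hε0 hε1
  have hcard : (0 : ℝ) ≤ Fintype.card ι - 1 := by
    have h1 : (1 : ℝ) ≤ Fintype.card ι := by exact_mod_cast Fintype.card_pos_iff.mpr ⟨μ⟩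
    linarith
  calc ‖J T (fluct η A) η μ x‖
      ≤ ε * (ξ ^ 3)⁻¹ + (Fintype.card ι - 1) * (η⁻¹ * errB η (ε * ξ⁻¹) (η * (ε * (ξ ^ 2)⁻¹))) := h
    _ ≤ ε * (ξ ^ 3)⁻¹ + (Fintype.card ι - 1) * (10 ^ 4 * (ε ^ 2 * (ξ ^ 3)⁻¹)) := by gcongr
    _ = (1 + 10 ^ 4 * (Fintype.card ι - 1) * ε) * (ε * (ξ ^ 3)⁻¹) := by ring

/-- … and the crude form `|J| ≦ 10⁴·d·εξ⁻³` (`ε ≦ 1`, `d = |ι| ≧ 1`). [folklore]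
[cite: Balaban1985BackgroundPropagators, (3.35)–(3.36) p.396, (3.11) p.392, p.422] -/
theorem norm_J_fluct_le_crude (hT : ∀ μ ν x, T μ (T ν x) = T ν (T μ x)) {η ξ ε : ℝ} (hη : 0 < η)
    (hηξ : η ≤ ξ) (hε0 : 0 ≤ ε) (hε1 : ε ≤ 1) (A : ι → S → 𝔸)
    (hA : ∀ κ z, ‖A κ z‖ ≤ ε * ξ⁻¹)
    (hD : ∀ κ ν z, ‖covD T (fun _ _ => (1 : 𝔸ˣ)) κ (A ν) z‖ ≤ η * (ε * (ξ ^ 2)⁻¹))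
    (h36 : ∀ μ x, ‖divPη T (fun _ _ => (1 : 𝔸ˣ)) η (curlη T (fun _ _ => (1 : 𝔸ˣ)) η A) μ x‖ ≤ ε * (ξ ^ 3)⁻¹)
    (μ : ι) (x : S) :
    ‖J T (fluct η A) η μ x‖ ≤ 10 ^ 4 * Fintype.card ι * (ε * (ξ ^ 3)⁻¹) := by
  have h := norm_J_fluct_le_scaled T hT hη hηξ hε0 hε1 A hA hD h36 μ x
  have hξ0 : 0 < ξ := hη.trans_le hηξ
  have h1 : (1 : ℝ) ≤ Fintype.card ι := by exact_mod_cast Fintype.card_pos_iff.mpr ⟨μ⟩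
  have hcoef : 1 + 10 ^ 4 * (Fintype.card ι - 1) * ε ≤ 10 ^ 4 * (Fintype.card ι : ℝ) := by
    nlinarith
  exact h.trans (mul_le_mul_of_nonneg_right hcoef (by positivity))

/-- **(3.35)–(3.36) IN THE PRINTED LETTERS ⟹ `|J| ≦ (1 + 10⁴(d−1)C)·C·(Lʲη)⁻³`** in the gauge `U = e^{iηA}` (p. 396: «for a
configuration U there exists a gauge transformation u on □ such that U^u = e^{iηA}. and if the index of □ is j, then
|A| < O(1)Mα₀(Lʲη)⁻¹, |∇^ηA| < O(1)Mα₀(Lʲη)⁻² on □, … (3.35)  |∂^{η*}∂^ηA| < O(1)Mα₀(Lʲη)⁻³ on □. (3.36)»; `C` = the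
print's `O(1)Mα₀`, assumed `≦ 1` («We will need α₀ so small that O(1)Mα₀ is still a sufficiently small number»), `L ≧ 1`;
`∇^η` read as the unit-lattice difference divided by `η`, as in `B9Eq369Product.norm_eta_inv_smul_le_iff`). This is the
bound «the configuration J is small» of p. 421 / the `(Lʲη)⁻³` of p. 422. [folklore]
[cite: Balaban1985BackgroundPropagators, (3.35)–(3.36) p.396, (3.11) p.392, p.421, p.422] -/
theorem norm_J_fluct_le_printed (hT : ∀ μ ν x, T μ (T ν x) = T ν (T μ x)) {η L C : ℝ} {j : ℕ} (hη : 0 < η)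
    (hL : 1 ≤ L) (hC0 : 0 ≤ C) (hC1 : C ≤ 1) (A : ι → S → 𝔸)
    (h335a : ∀ κ z, ‖A κ z‖ ≤ C * (L ^ j * η)⁻¹)
    (h335b : ∀ κ ν z, ‖covD T (fun _ _ => (1 : 𝔸ˣ)) κ (A ν) z‖ ≤ η * (C * ((L ^ j * η) ^ 2)⁻¹))
    (h336 : ∀ μ x,
      ‖divPη T (fun _ _ => (1 : 𝔸ˣ)) η (curlη T (fun _ _ => (1 : 𝔸ˣ)) η A) μ x‖ ≤ C * ((L ^ j * η) ^ 3)⁻¹)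
    (μ : ι) (x : S) :
    ‖J T (fluct η A) η μ x‖ ≤ (1 + 10 ^ 4 * (Fintype.card ι - 1) * C) * (C * ((L ^ j * η) ^ 3)⁻¹) := by
  have hηξ : η ≤ L ^ j * η := by
    have h1 : (1 : ℝ) ≤ L ^ j := one_le_pow₀ hL
    nlinarith
  exact norm_J_fluct_le_scaled T hT hη hηξ hC0 hC1 A h335a h335b h336 μ x

end Scaled

/-! ## §8  A general background: the gauge `u` of (3.35) and locality -/

section Gauge

variable {𝔸 : Type*} [NormedRing 𝔸] [NormedAlgebra ℂ 𝔸] [CompleteSpace 𝔸] {S : Type*} {ι : Type*}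
variable (T : ι → Equiv.Perm S) [Fintype ι] [LinearOrder ι]

omit [CompleteSpace 𝔸] in
/-- **GAUGE TRANSFER** ((3.30) `J^u = R(u)J`, `B9Eq3117Current.J_gaugeTr` BY NAME): a bound on the current of the
transformed configuration `U^u` at the bond `⟨x, x+e_μ⟩` is a bound on the current of `U` there, provided
`‖u(x)‖, ‖u(x)⁻¹‖ ≦ 1` (e.g. `u` with values in a compact `G ⊂ U(N)` in an operator norm). [folklore]
[cite: Balaban1985BackgroundPropagators, (3.30) p.395, (3.35) p.396] -/
theorem norm_J_le_of_gaugeTr (hT : ∀ μ ν x, T μ (T ν x) = T ν (T μ x)) (U : ι → S → 𝔸ˣ) (u : S → 𝔸ˣ)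
    (η : ℝ) (μ : ι) (x : S) (hu : ‖(u x : 𝔸)‖ ≤ 1) (hu' : ‖(((u x)⁻¹ : 𝔸ˣ) : 𝔸)‖ ≤ 1) {B : ℝ}
    (hB : ‖J T (gaugeTr T u U) η μ x‖ ≤ B) :
    ‖J T U η μ x‖ ≤ B := by
  have h : J T U η μ x = R (u x)⁻¹ (J T (gaugeTr T u U) η μ x) := by
    rw [J_gaugeTr T U hT, R_inv_R]
  rw [h]
  refine (norm_R_le _ _).trans ?_
  rw [inv_inv]
  have hB0 : 0 ≤ B := (norm_nonneg _).trans hB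
  calc ‖(((u x)⁻¹ : 𝔸ˣ) : 𝔸)‖ * ‖J T (gaugeTr T u U) η μ x‖ * ‖(u x : 𝔸)‖ ≤ 1 * B * 1 :=
        mul_le_mul (mul_le_mul hu' hB (norm_nonneg _) zero_le_one) hu (norm_nonneg _) (by positivity)
    _ = B := by ring

omit [CompleteSpace 𝔸] in
/-- **LOCALITY OF THE CURRENT**: `J_μ(x)` depends on the configuration only through the bonds of the `2(d−1)` plaquettes
`p_{νμ}(x)`, `p_{νμ}(x − e_ν)` — all based at sites of the stencil `x`, `x + e_κ`, `x − e_ν`, `x − e_ν + e_μ`; two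
configurations agreeing on the bonds out of a site set `N` containing the stencil have the same `J_μ(x)`. [folklore]
[cite: Balaban1985BackgroundPropagators, (3.11) p.392, (3.8)–(3.9) p.392] -/
theorem J_congr {V W : ι → S → 𝔸ˣ} (η : ℝ) (μ : ι) (x : S) (N : Set S) (hVW : ∀ κ, ∀ z ∈ N, V κ z = W κ z)
    (hx : x ∈ N) (hN₁ : ∀ κ, T κ x ∈ N) (hN₂ : ∀ ν, (T ν).symm x ∈ N) (hN₃ : ∀ ν, T μ ((T ν).symm x) ∈ N) :
    J T V η μ x = J T W η μ x := by
  rw [J_eq_sum, J_eq_sum]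
  congr 1
  refine Finset.sum_congr rfl fun ν _ => ?_
  have hy : T ν ((T ν).symm x) = x := (T ν).apply_symm_apply x
  simp only [covDstar, plaqU, hy, hVW ν x hx, hVW μ x hx, hVW ν _ (hN₂ ν), hVW μ _ (hN₂ ν), hVW ν _ (hN₁ μ),
    hVW μ _ (hN₁ ν), hVW ν _ (hN₃ ν)]

/-- **(3.35)–(3.36) ⟹ `|J(b)| ≦ t + (d−1)η⁻¹B`, GENERAL BACKGROUND, LOCAL FORM**: `U` arbitrary units; a gauge `u` with
`U^u = e^{iηA}` on the bonds out of a site set `N` («on □») containing the stencil of `b = ⟨x, x+e_μ⟩`, `‖u(x)‖, ‖u(x)⁻¹‖ ≦ 1`;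
`|A| ≦ a` and unit-lattice differences `≦ g` on `N`; `|(∂^{η*}∂^ηA)_μ(x)| ≦ t`. [folklore]
[cite: Balaban1985BackgroundPropagators, (3.35)–(3.36) p.396, (3.30) p.395, (3.11) p.392, p.422] -/
theorem norm_J_le_local (hT : ∀ μ ν x, T μ (T ν x) = T ν (T μ x)) {η : ℝ} (hη : 0 < η) (U : ι → S → 𝔸ˣ)
    (u : S → 𝔸ˣ) (A : ι → S → 𝔸) (N : Set S) {a g t : ℝ} (μ : ι) (x : S)
    (hx : x ∈ N) (hN₁ : ∀ κ, T κ x ∈ N) (hN₂ : ∀ ν, (T ν).symm x ∈ N) (hN₃ : ∀ ν, T μ ((T ν).symm x) ∈ N)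
    (hu : ‖(u x : 𝔸)‖ ≤ 1) (hu' : ‖(((u x)⁻¹ : 𝔸ˣ) : 𝔸)‖ ≤ 1)
    (hgauge : ∀ κ, ∀ z ∈ N, gaugeTr T u U κ z = fluct η A κ z)
    (hA : ∀ κ, ∀ z ∈ N, ‖A κ z‖ ≤ a)
    (hD : ∀ κ ν, ∀ z ∈ N, ‖covD T (fun _ _ => (1 : 𝔸ˣ)) κ (A ν) z‖ ≤ g)
    (h36 : ‖divPη T (fun _ _ => (1 : 𝔸ˣ)) η (curlη T (fun _ _ => (1 : 𝔸ˣ)) η A) μ x‖ ≤ t) :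
    ‖J T U η μ x‖ ≤ t + (Fintype.card ι - 1) * (η⁻¹ * errB η a g) := by
  refine norm_J_le_of_gaugeTr T hT U u η μ x hu hu' ?_
  rw [J_congr T η μ x N hgauge hx hN₁ hN₂ hN₃]
  exact norm_J_fluct_le_local T hT hη A N μ x hx hN₁ hN₂ hN₃ hA hD h36

/-- **(3.35)–(3.36) ⟹ `|J| ≦ (1 + 10⁴(d−1)C)·C·(Lʲη)⁻³`, GENERAL BACKGROUND, PRINTED LETTERS** — the form in which p. 421
(«the configuration J is small») and p. 422 («From the regularity condition (3.36) … ≦ O(1)Mα₀(Lʲη)⁻³») use (3.36), and the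
shape of the hypotheses `hJ` of `B9Ineq3131Assembly.ineq3131_assembled` ((3.131)) and `h336` of
`B9Delta2Def134.ineq3137a_of_3133_336` ((3.137)), with `c_J = 1 + 10⁴(d−1)C ≦ 10⁴d`: `U` arbitrary units with a gauge `u`
(`‖u‖, ‖u⁻¹‖ ≦ 1`) such that `U^u = e^{iηA}` on the lattice, `A` obeying (3.35)–(3.36) with `O(1)Mα₀ = C ≦ 1`, `L ≧ 1`.
[folklore] [cite: Balaban1985BackgroundPropagators, (3.35)–(3.36) p.396, (3.30) p.395, (3.11) p.392, p.421, p.422] -/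
theorem norm_J_le_printed (hT : ∀ μ ν x, T μ (T ν x) = T ν (T μ x)) {η L C : ℝ} {j : ℕ} (hη : 0 < η)
    (hL : 1 ≤ L) (hC0 : 0 ≤ C) (hC1 : C ≤ 1) (U : ι → S → 𝔸ˣ) (u : S → 𝔸ˣ) (A : ι → S → 𝔸)
    (hu : ∀ x, ‖(u x : 𝔸)‖ ≤ 1) (hu' : ∀ x, ‖(((u x)⁻¹ : 𝔸ˣ) : 𝔸)‖ ≤ 1) (hgauge : gaugeTr T u U = fluct η A)
    (h335a : ∀ κ z, ‖A κ z‖ ≤ C * (L ^ j * η)⁻¹)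
    (h335b : ∀ κ ν z, ‖covD T (fun _ _ => (1 : 𝔸ˣ)) κ (A ν) z‖ ≤ η * (C * ((L ^ j * η) ^ 2)⁻¹))
    (h336 : ∀ μ x,
      ‖divPη T (fun _ _ => (1 : 𝔸ˣ)) η (curlη T (fun _ _ => (1 : 𝔸ˣ)) η A) μ x‖ ≤ C * ((L ^ j * η) ^ 3)⁻¹)
    (μ : ι) (x : S) :
    ‖J T U η μ x‖ ≤ (1 + 10 ^ 4 * (Fintype.card ι - 1) * C) * (C * ((L ^ j * η) ^ 3)⁻¹) := by
  refine norm_J_le_of_gaugeTr T hT U u η μ x (hu x) (hu' x) ?_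
  rw [hgauge]
  exact norm_J_fluct_le_printed T hT hη hL hC0 hC1 A h335a h335b h336 μ x

/-- … crude constant: `|J(b)| ≦ 10⁴·d·C·(Lʲη)⁻³` for every bond — `c_J·Mα₀·(Lʲη)⁻³` with `c_J·Mα₀ = 10⁴d·C`. [folklore]
[cite: Balaban1985BackgroundPropagators, (3.35)–(3.36) p.396, (3.11) p.392, p.422] -/
theorem norm_J_le_printed_crude (hT : ∀ μ ν x, T μ (T ν x) = T ν (T μ x)) {η L C : ℝ} {j : ℕ} (hη : 0 < η)
    (hL : 1 ≤ L) (hC0 : 0 ≤ C) (hC1 : C ≤ 1) (U : ι → S → 𝔸ˣ) (u : S → 𝔸ˣ) (A : ι → S → 𝔸)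
    (hu : ∀ x, ‖(u x : 𝔸)‖ ≤ 1) (hu' : ∀ x, ‖(((u x)⁻¹ : 𝔸ˣ) : 𝔸)‖ ≤ 1) (hgauge : gaugeTr T u U = fluct η A)
    (h335a : ∀ κ z, ‖A κ z‖ ≤ C * (L ^ j * η)⁻¹)
    (h335b : ∀ κ ν z, ‖covD T (fun _ _ => (1 : 𝔸ˣ)) κ (A ν) z‖ ≤ η * (C * ((L ^ j * η) ^ 2)⁻¹))
    (h336 : ∀ μ x,
      ‖divPη T (fun _ _ => (1 : 𝔸ˣ)) η (curlη T (fun _ _ => (1 : 𝔸ˣ)) η A) μ x‖ ≤ C * ((L ^ j * η) ^ 3)⁻¹)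
    (μ : ι) (x : S) :
    ‖J T U η μ x‖ ≤ 10 ^ 4 * Fintype.card ι * (C * ((L ^ j * η) ^ 3)⁻¹) := by
  refine norm_J_le_of_gaugeTr T hT U u η μ x (hu x) (hu' x) ?_
  rw [hgauge]
  have hηξ : η ≤ L ^ j * η := by
    have h1 : (1 : ℝ) ≤ L ^ j := one_le_pow₀ hL
    nlinarith
  exact norm_J_fluct_le_crude T hT hη hηξ hC0 hC1 A h335a h335b h336 μ x

end Gauge

/-! ## §9  Block-indexed form: the hypothesis shape `|J(b)| ≦ c_J·Mα₀·(L^{j(b)}η)⁻³` of the consumers -/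

section Blocks

variable {𝔸 : Type*} [NormedRing 𝔸] [NormedAlgebra ℂ 𝔸] [CompleteSpace 𝔸] {S : Type*} {ι : Type*}
variable (T : ι → Equiv.Perm S) [Fintype ι] [LinearOrder ι]

/-- **LOCAL FORM AT THE SCALES OF (3.35)–(3.36)**: general background `U`, a gauge `u` with `U^u = e^{iηA}` on the bonds out of
`N` ⊇ stencil of `b = ⟨x, x+e_μ⟩`, `‖u(x)‖, ‖u(x)⁻¹‖ ≦ 1`, and on `N`: `|A| ≦ εξ⁻¹`, unit differences `≦ η·εξ⁻²`,
`|(∂^{η*}∂^ηA)_μ(x)| ≦ εξ⁻³` (`0 < η ≦ ξ`, `0 ≦ ε ≦ 1`) ⟹ `|J_μ(x)| ≦ (1 + 10⁴(d−1)ε)·εξ⁻³`. [folklore]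
[cite: Balaban1985BackgroundPropagators, (3.35)–(3.36) p.396, (3.30) p.395, (3.11) p.392, p.422] -/
theorem norm_J_le_local_scaled (hT : ∀ μ ν x, T μ (T ν x) = T ν (T μ x)) {η ξ ε : ℝ} (hη : 0 < η) (hηξ : η ≤ ξ)
    (hε0 : 0 ≤ ε) (hε1 : ε ≤ 1) (U : ι → S → 𝔸ˣ) (u : S → 𝔸ˣ) (A : ι → S → 𝔸) (N : Set S) (μ : ι) (x : S)
    (hx : x ∈ N) (hN₁ : ∀ κ, T κ x ∈ N) (hN₂ : ∀ ν, (T ν).symm x ∈ N) (hN₃ : ∀ ν, T μ ((T ν).symm x) ∈ N)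
    (hu : ‖(u x : 𝔸)‖ ≤ 1) (hu' : ‖(((u x)⁻¹ : 𝔸ˣ) : 𝔸)‖ ≤ 1)
    (hgauge : ∀ κ, ∀ z ∈ N, gaugeTr T u U κ z = fluct η A κ z)
    (hA : ∀ κ, ∀ z ∈ N, ‖A κ z‖ ≤ ε * ξ⁻¹)
    (hD : ∀ κ ν, ∀ z ∈ N, ‖covD T (fun _ _ => (1 : 𝔸ˣ)) κ (A ν) z‖ ≤ η * (ε * (ξ ^ 2)⁻¹))
    (h36 : ‖divPη T (fun _ _ => (1 : 𝔸ˣ)) η (curlη T (fun _ _ => (1 : 𝔸ˣ)) η A) μ x‖ ≤ ε * (ξ ^ 3)⁻¹) :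
    ‖J T U η μ x‖ ≤ (1 + 10 ^ 4 * (Fintype.card ι - 1) * ε) * (ε * (ξ ^ 3)⁻¹) := by
  have h := norm_J_le_local T hT hη U u A N μ x hx hN₁ hN₂ hN₃ hu hu' hgauge hA hD h36
  have hb := budget hη hηξ hε0 hε1
  have hcard : (0 : ℝ) ≤ Fintype.card ι - 1 := by
    have h1 : (1 : ℝ) ≤ Fintype.card ι := by exact_mod_cast Fintype.card_pos_iff.mpr ⟨μ⟩
    linarith
  calc ‖J T U η μ x‖
      ≤ ε * (ξ ^ 3)⁻¹ + (Fintype.card ι - 1) * (η⁻¹ * errB η (ε * ξ⁻¹) (η * (ε * (ξ ^ 2)⁻¹))) := h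
    _ ≤ ε * (ξ ^ 3)⁻¹ + (Fintype.card ι - 1) * (10 ^ 4 * (ε ^ 2 * (ξ ^ 3)⁻¹)) := by gcongr
    _ = (1 + 10 ^ 4 * (Fintype.card ι - 1) * ε) * (ε * (ξ ^ 3)⁻¹) := by ring

/-- **THE REGULARITY DATUM OF (3.35)–(3.36) AT ONE BOND** `b = ⟨x, x+e_μ⟩`, scale `ξ` (= `Lʲη` of the cube □ of index `j`
carrying the bond), constant `C` (= the print's `O(1)Mα₀`): a gauge `u` («there exists a gauge transformation u on □»), a field
`A` («U^u = e^{iηA}») and a site set `N` («on □») containing the stencil of `b`, with `‖u(x)‖, ‖u(x)⁻¹‖ ≦ 1`, `U^u = e^{iηA}` on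
the bonds out of `N`, `|A| ≦ Cξ⁻¹` and unit-lattice differences `≦ η·Cξ⁻²` on `N` ((3.35)), and `|(∂^{η*}∂^ηA)_μ(x)| ≦ Cξ⁻³`
((3.36) at `b`). [cite: Balaban1985BackgroundPropagators, (3.35)–(3.36) p.396] -/
def RegularAt (U : ι → S → 𝔸ˣ) (η C ξ : ℝ) (μ : ι) (x : S) : Prop :=
  ∃ (u : S → 𝔸ˣ) (A : ι → S → 𝔸) (N : Set S),
    x ∈ N ∧ (∀ κ, T κ x ∈ N) ∧ (∀ ν, (T ν).symm x ∈ N) ∧ (∀ ν, T μ ((T ν).symm x) ∈ N) ∧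
    ‖(u x : 𝔸)‖ ≤ 1 ∧ ‖(((u x)⁻¹ : 𝔸ˣ) : 𝔸)‖ ≤ 1 ∧
    (∀ κ, ∀ z ∈ N, gaugeTr T u U κ z = fluct η A κ z) ∧
    (∀ κ, ∀ z ∈ N, ‖A κ z‖ ≤ C * ξ⁻¹) ∧
    (∀ κ ν, ∀ z ∈ N, ‖covD T (fun _ _ => (1 : 𝔸ˣ)) κ (A ν) z‖ ≤ η * (C * (ξ ^ 2)⁻¹)) ∧
    ‖divPη T (fun _ _ => (1 : 𝔸ˣ)) η (curlη T (fun _ _ => (1 : 𝔸ˣ)) η A) μ x‖ ≤ C * (ξ ^ 3)⁻¹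

/-- **(3.35)–(3.36) AT A BOND ⟹ `|J(b)| ≦ (1 + 10⁴(d−1)C)·C·ξ⁻³`** (`C ≦ 1`, `η ≦ ξ`). [folklore]
[cite: Balaban1985BackgroundPropagators, (3.35)–(3.36) p.396, (3.11) p.392, p.422] -/
theorem norm_J_le_of_regularAt (hT : ∀ μ ν x, T μ (T ν x) = T ν (T μ x)) {η C ξ : ℝ} (hη : 0 < η) (hηξ : η ≤ ξ)
    (hC0 : 0 ≤ C) (hC1 : C ≤ 1) (U : ι → S → 𝔸ˣ) (μ : ι) (x : S) (h : RegularAt T U η C ξ μ x) :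
    ‖J T U η μ x‖ ≤ (1 + 10 ^ 4 * (Fintype.card ι - 1) * C) * (C * (ξ ^ 3)⁻¹) := by
  obtain ⟨u, A, N, hx, hN₁, hN₂, hN₃, hu, hu', hgauge, hA, hD, h36⟩ := h
  exact norm_J_le_local_scaled T hT hη hηξ hC0 hC1 U u A N μ x hx hN₁ hN₂ hN₃ hu hu' hgauge hA hD h36

/-- **BLOCK-INDEXED FORM = THE CONSUMERS' HYPOTHESIS SHAPE.**  With a block map `blk : S → 𝔅` and scales `len(y)` (= `L^{j(y)}η ≧ η`):
if (3.35)–(3.36) hold at every bond at the scale of its block, then `∀ μ x, |J_μ(x)| ≦ (10⁴d)·C·(len(blk x)³)⁻¹` — the `hJ` of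
`B9Ineq3131Assembly.ineq3131_assembled` with `c_J = 10⁴d`, `Mα₀ ↦ C`, and (through `Jsup y := 10⁴d·C·len(y)⁻³`) the `h336` of
`B9Delta2Def134.ineq3137a_of_3133_336`. [folklore] [cite: Balaban1985BackgroundPropagators, (3.35)–(3.36) p.396, (3.131) p.422, (3.137) p.423] -/
theorem norm_J_le_blocks (hT : ∀ μ ν x, T μ (T ν x) = T ν (T μ x)) {η C : ℝ} (hη : 0 < η) (hC0 : 0 ≤ C) (hC1 : C ≤ 1)
    (U : ι → S → 𝔸ˣ) {Y : Type*} (blk : S → Y) (len : Y → ℝ) (hlen : ∀ y, η ≤ len y)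
    (hreg : ∀ μ x, RegularAt T U η C (len (blk x)) μ x) (μ : ι) (x : S) :
    ‖J T U η μ x‖ ≤ 10 ^ 4 * Fintype.card ι * C * (len (blk x) ^ 3)⁻¹ := by
  have h := norm_J_le_of_regularAt T hT hη (hlen (blk x)) hC0 hC1 U μ x (hreg μ x)
  have hξ0 : 0 < len (blk x) := hη.trans_le (hlen (blk x))
  have h1 : (1 : ℝ) ≤ Fintype.card ι := by exact_mod_cast Fintype.card_pos_iff.mpr ⟨μ⟩
  have hcoef : 1 + 10 ^ 4 * (Fintype.card ι - 1) * C ≤ 10 ^ 4 * (Fintype.card ι : ℝ) := by nlinarith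
  calc ‖J T U η μ x‖ ≤ (1 + 10 ^ 4 * (Fintype.card ι - 1) * C) * (C * (len (blk x) ^ 3)⁻¹) := h
    _ ≤ 10 ^ 4 * (Fintype.card ι : ℝ) * (C * (len (blk x) ^ 3)⁻¹) :=
        mul_le_mul_of_nonneg_right hcoef (by positivity)
    _ = 10 ^ 4 * Fintype.card ι * C * (len (blk x) ^ 3)⁻¹ := by ring

end Blocks

end Literature.MathematicalPhysics.QuantumFieldTheory.Balaban1983to89.B9Eq336CurrentBound
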